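import Literature.AlgebraicGeometry.Resolution.RegularLocalOrderValuation
import HarnessLib

/-!
# [OURS · L1 W4.2] σ-LAYER — `Corridor3SigmaRowIdeal`: THE ROW-IDEAL DICTIONARY `J := I^{S₀} + N^{m}` (threshold `c = m·S₀`) — definition, the ORDER
# DICTIONARY «`J ⊆ 𝔪^{m·S₀} ⟺ I ⊆ 𝔪^{m} ∧ N ⊆ 𝔪^{S₀}`» in a regular local ring (and at every prime with regular localisation: `Sing_{mS₀}(J) = {ord I ≥ m} ∩
# {ord N ≥ S₀}`, the ROW STRATUM), TRANSFORM COMMUTATION «`I ↦ (t^m)·I′`, `N ↦ (t^{S₀})·N′` ⇒ `J ↦ (t^{mS₀})·J′`» with its colon form, and the PERMISSIBILITY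
# COROLLARY «`J`-order `≥ m·S₀` at a prime ⇒ `I`-order `≥ m` ∧ `N`-order `≥ S₀`»
# (crux chain w42 `SigmaMaxModifications` stmt-ResolutionOfSingularities-18506 / conjunct `SigmaMaxModificationsCorridor3` stmt-ResolutionOfSingularities-19249;
# res-L1-w42-plan-1 DESK WORD 2026-08-27T19:51:29Z (iv-desk) items (a)–(d), RULING v3.14-51 (51C) «(o2, in hand) `…Corridor3SigmaRowIdeal.lean` — carry R regular
# local (order = 𝔪-adic valuation)»; needed under every reading of card C13 (ROW-P) and by cards U/V; READER idea-1 g12 (Sketch C13 §4–§5 the model);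
# seat res-L1-type-o2 g9 = «res-type-067/068 SUCCESSOR»; `--supports stmt-ResolutionOfSingularities-19249 --as helper`, counted 0)

HONEST FRAMING. OURS bookkeeping; elementary ideal algebra over Mathlib + the tree's `𝔪`-adic order valuation of a regular local ring (`adicOrder_pow`,
`RegularLocalOrderValuation.lean`, Zariski–Samuel VIII §1). Every `theorem` PROVED, one `def`; no named fact, no axiom, no instance, no notation. NOTHING here
is a statement of H. Hironaka's manuscript [Hironaka2017] nor of Cutkosky 2009 / Cossart–Jannsen–Saito (whose procedures CONSUME the row ideal; their theorems
enter the campaign only as named facts elsewhere). AI-typed; AI review weaker than expert review.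

THRESHOLD CONVENTION (desk (a) «say which»): the threshold of `J` is `c := m·S₀` — the SAME `c` as `TameLow.CoeffDatum.c` (p558585); no `m!`-normalised
variant is introduced (the coefficient-ideal side already works in the `c`-currency, DESK WORD 18:33:36Z (s3)).

## Contents (namespace `…Theorems.SigmaMaxModificationsCorridor3.Sigma`)

* §1 (a) **`rowIdeal I N m S₀ := I ^ S₀ ⊔ N ^ m`**, `rowIdeal_le_iff`, `map_rowIdeal` (any ring map: `(J).map φ = rowIdeal (I.map φ) (N.map φ) m S₀`),
  `le_rowIdeal_left/right`, monotonicity.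
* §2 (c) **TRANSFORM COMMUTATION `map_rowIdeal_eq_of_transform`**: `I.map φ = (t^m)·I′ ∧ N.map φ = (t^{S₀})·N′ ⇒ (rowIdeal I N m S₀).map φ = (t^{m·S₀}) ·
  rowIdeal I′ N′ m S₀` (point- or curve-step shaped `φ` alike — pure ideal algebra), `colon_span_singleton_mul_eq` (`((a)·K : (a)) = K` for a non-zero-divisor
  `a`) and the COLON FORM `colon_map_rowIdeal_eq` (`(J.map φ : (t^{mS₀})) = rowIdeal I′ N′ m S₀` when `t` is a non-zero-divisor).
* §3 (b) **ORDER DICTIONARY** in a REGULAR local ring (`ord = adicOrder`, a valuation): `pow_le_maximalIdeal_pow_mul_iff` (`I^k ⊆ 𝔪^{k·a} ⟺ I ⊆ 𝔪^a`, `k ≥ 1`;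
  via `adicOrder_pow`), **`rowIdeal_le_maximalIdeal_pow_iff`** (`J ⊆ 𝔪^{m·S₀} ⟺ I ⊆ 𝔪^m ∧ N ⊆ 𝔪^{S₀}`, `m, S₀ ≥ 1`); AT A PRIME `P` with regular localisation
  `Rₚ`: **`map_rowIdeal_le_iff_of_isLocalization`** — «`ord_P J ≥ m·S₀ ⟺ ord_P I ≥ m ∧ ord_P N ≥ S₀`», orders read as `K.map (algebraMap R Rₚ) ≤ 𝔪_{Rₚ}^n`
  (symbolic-power form `le_comap_iff` recorded) ⇒ **`sing_rowIdeal_iff`**: `Sing_{mS₀}(J) = {ord I ≥ m} ∩ {ord N ≥ S₀}` pointwise over the regular locus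
  (= the ROW STRATUM `T_{S₀}` on the contact threefold, given `ord N ≤ S₀` there).
* §4 (d) **PERMISSIBILITY COROLLARY** `order_le_of_rowIdeal_order_le`: a prime `Q` (regular localisation) with `ord_Q J ≥ m·S₀` has `ord_Q I ≥ m ∧ ord_Q N ≥ S₀`
  («`J`-permissible ⇒ `X`-legal ∧ `N`-equimultiple» at ring level; the geometric words — normal flatness, B-snc — are the consumers').

VACUITY SELF-CHECK. `rowIdeal` is a definition; §3's `iff` has content in both directions (it FAILS for `k = 0` / non-regular rings — e.g. in `k[x,y]/(xy)`
orders are not additive — hence the binders `0 < k`, `IsRegularLocalRing`); §2 holds in any commutative ring.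
-/

set_option linter.dupNamespace false -- mandated namespace of this single-conjunct summit

namespace Summit.ResolutionOfSingularities.ResolutionOfSingularities.Theorems.SigmaMaxModificationsCorridor3.Sigma

open IsLocalRing Literature.AlgebraicGeometry.Resolution

universe u v

/-! ## §1. (a) The row ideal -/

section Def

variable {A : Type u} [CommRing A]

/-- [OURS · L1 W4.2] **THE ROW IDEAL `J := I^{S₀} + N^{m}`** of a tame row (`I = M·N` the ideal of record on the contact threefold germ, `N` its residual
factor of order `S₀`, `m` the order of `I`); its natural threshold is `c = m·S₀`. Replaces the role of the «intersection object» of RULING v3.14-47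
SUPPLEMENT (MD′) (TL1); NOT a statement of the manuscript. [folklore] -/
def rowIdeal (I N : Ideal A) (m S₀ : ℕ) : Ideal A := I ^ S₀ ⊔ N ^ m

variable (I N : Ideal A) (m S₀ : ℕ)

/-- Unfolding. [folklore] -/
theorem rowIdeal_def : rowIdeal I N m S₀ = I ^ S₀ ⊔ N ^ m := rfl

/-- `J ≤ K ↔ I^{S₀} ≤ K ∧ N^m ≤ K`. [folklore] -/
theorem rowIdeal_le_iff {K : Ideal A} : rowIdeal I N m S₀ ≤ K ↔ I ^ S₀ ≤ K ∧ N ^ m ≤ K := sup_le_iff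

/-- `I^{S₀} ≤ J`. [folklore] -/
theorem pow_le_rowIdeal_left : I ^ S₀ ≤ rowIdeal I N m S₀ := le_sup_left

/-- `N^m ≤ J`. [folklore] -/
theorem pow_le_rowIdeal_right : N ^ m ≤ rowIdeal I N m S₀ := le_sup_right

/-- Monotone in `I` and `N`. [folklore] -/
theorem rowIdeal_mono {I I' N N' : Ideal A} (hI : I ≤ I') (hN : N ≤ N') (m S₀ : ℕ) : rowIdeal I N m S₀ ≤ rowIdeal I' N' m S₀ :=
  sup_le_sup (Ideal.pow_right_mono hI S₀) (Ideal.pow_right_mono hN m)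

/-- **The row ideal commutes with extension along ANY ring map** (powers and sums do). [folklore] -/
theorem map_rowIdeal {B : Type v} [CommRing B] (φ : A →+* B) :
    (rowIdeal I N m S₀).map φ = rowIdeal (I.map φ) (N.map φ) m S₀ := by
  rw [rowIdeal, rowIdeal, Ideal.map_sup, Ideal.map_pow, Ideal.map_pow]

end Def

/-! ## §2. (c) Transform commutation -/

section Transform

variable {A : Type u} [CommRing A] {B : Type v} [CommRing B]

/-- `((t^a) · K)^k = (t^{a·k}) · K^k`. [folklore] -/
theorem span_singleton_pow_mul_pow (t : B) (a k : ℕ) (K : Ideal B) :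
    (Ideal.span {t ^ a} * K) ^ k = Ideal.span {t ^ (a * k)} * K ^ k := by
  rw [mul_pow, Ideal.span_singleton_pow, ← pow_mul]

/-- **(c) TRANSFORM COMMUTATION**: if along `φ` the ideal `I` transforms as `(t^m)·I′` and `N` as `(t^{S₀})·N′` (controlled / strict transforms with the
exceptional parameter `t`; point- or curve-step alike), then the row ideal transforms as `(t^{m·S₀}) · rowIdeal I′ N′ m S₀` — «controlled transforms commute»
(SUPPLEMENT (MD′) (TL1)). [folklore] -/
theorem map_rowIdeal_eq_of_transform (φ : A →+* B) {I N : Ideal A} {I' N' : Ideal B} {t : B} {m S₀ : ℕ}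
    (hI : I.map φ = Ideal.span {t ^ m} * I') (hN : N.map φ = Ideal.span {t ^ S₀} * N') :
    (rowIdeal I N m S₀).map φ = Ideal.span {t ^ (m * S₀)} * rowIdeal I' N' m S₀ := by
  rw [map_rowIdeal, rowIdeal, rowIdeal, hI, hN, span_singleton_pow_mul_pow, span_singleton_pow_mul_pow, Nat.mul_comm S₀ m, Ideal.mul_sup]

/-- **`((a)·K : (a)) = K` for a non-zero-divisor `a`.** [folklore] -/
theorem colon_span_singleton_mul_eq {a : B} (ha : a ∈ nonZeroDivisors B) (K : Ideal B) :
    (Ideal.span {a} * K).colon (Ideal.span {a}) = K := by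
  apply le_antisymm
  · intro x hx
    have hxa : x * a ∈ Ideal.span {a} * K := by
      have := Submodule.mem_colon.mp hx a (Ideal.mem_span_singleton_self a)
      rwa [smul_eq_mul] at this
    obtain ⟨k, hk, hak⟩ := Ideal.mem_span_singleton_mul.mp hxa
    have : x = k := by
      have h1 : x * a = k * a := by rw [← hak, mul_comm]
      exact (mul_cancel_right_mem_nonZeroDivisors ha).mp h1
    rw [this]
    exact hk
  · intro k hk
    refine Submodule.mem_colon.mpr fun p hp => ?_
    obtain ⟨r, rfl⟩ := Ideal.mem_span_singleton'.mp hp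
    have hkr : k * (r * a) = a * (r * k) := by ring
    rw [smul_eq_mul, hkr]
    exact Ideal.mul_mem_mul (Ideal.mem_span_singleton_self a) (Ideal.mul_mem_left K r hk)

/-- **COLON FORM of the transform**: `(J·B : (t^{m·S₀})) = rowIdeal I′ N′ m S₀` when `t` is a non-zero-divisor of `B`. [folklore] -/
theorem colon_map_rowIdeal_eq (φ : A →+* B) {I N : Ideal A} {I' N' : Ideal B} {t : B} (ht : t ∈ nonZeroDivisors B) {m S₀ : ℕ}
    (hI : I.map φ = Ideal.span {t ^ m} * I') (hN : N.map φ = Ideal.span {t ^ S₀} * N') :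
    ((rowIdeal I N m S₀).map φ).colon (Ideal.span {t ^ (m * S₀)}) = rowIdeal I' N' m S₀ := by
  rw [map_rowIdeal_eq_of_transform φ hI hN]
  exact colon_span_singleton_mul_eq (pow_mem ht _) _

end Transform

/-! ## §3. (b) The order dictionary in a regular local ring -/

section Order

variable {R : Type u} [CommRing R] [IsRegularLocalRing R]

/-- **`I^k ⊆ 𝔪^{k·a} ⟺ I ⊆ 𝔪^a`** for `k ≥ 1` in a REGULAR local ring (the `𝔪`-adic order is a valuation: `ord(f^k) = k·ord f`). [cite: ZariskiSamuel1960, Ch. VIII §1 Thm. 1] -/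
theorem pow_le_maximalIdeal_pow_mul_iff (I : Ideal R) {k : ℕ} (hk : 0 < k) (a : ℕ) :
    I ^ k ≤ maximalIdeal R ^ (k * a) ↔ I ≤ maximalIdeal R ^ a := by
  refine ⟨fun h => ?_, fun h => by rw [Nat.mul_comm k a, pow_mul]; exact Ideal.pow_right_mono h k⟩
  intro f hf
  have hfk : f ^ k ∈ maximalIdeal R ^ (k * a) := h (Ideal.pow_mem_pow hf k)
  have h1 : ((k * a : ℕ) : ℕ∞) ≤ adicOrder (f ^ k) := (le_adicOrder_iff _ _).mpr hfk
  rw [adicOrder_pow, Nat.cast_mul] at h1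
  have h2 : (a : ℕ∞) ≤ adicOrder f := by
    by_cases htop : adicOrder f = ⊤
    · rw [htop]; exact le_top
    · obtain ⟨x, hx⟩ := ENat.ne_top_iff_exists.mp htop
      rw [← hx] at h1 ⊢
      have h3 : (k : ℕ∞) * (x : ℕ∞) = ((k * x : ℕ) : ℕ∞) := by push_cast; rfl
      rw [h3] at h1
      have h4 : k * a ≤ k * x := by exact_mod_cast h1
      exact_mod_cast Nat.le_of_mul_le_mul_left h4 hk
  exact (le_adicOrder_iff f a).mp h2

/-- **(b) ORDER DICTIONARY at the closed point: `J ⊆ 𝔪^{m·S₀} ⟺ I ⊆ 𝔪^m ∧ N ⊆ 𝔪^{S₀}`** (`m, S₀ ≥ 1`; `J = rowIdeal I N m S₀`). So «`ord J ≥ c = m·S₀`»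
is «`ord I ≥ m ∧ ord N ≥ S₀`» — the point lies in the ROW STRATUM. [cite: ZariskiSamuel1960, Ch. VIII §1 Thm. 1] -/
theorem rowIdeal_le_maximalIdeal_pow_iff (I N : Ideal R) {m S₀ : ℕ} (hm : 0 < m) (hS : 0 < S₀) :
    rowIdeal I N m S₀ ≤ maximalIdeal R ^ (m * S₀) ↔ I ≤ maximalIdeal R ^ m ∧ N ≤ maximalIdeal R ^ S₀ := by
  rw [rowIdeal_le_iff, Nat.mul_comm m S₀, pow_le_maximalIdeal_pow_mul_iff I hS m, Nat.mul_comm S₀ m,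
    pow_le_maximalIdeal_pow_mul_iff N hm S₀]

end Order

/-! ### At a prime with regular localisation: orders read through `algebraMap R Rₚ`
(stated for ANY `R`-algebra `Rₚ` that is a regular local ring — the localisation `IsLocalization.AtPrime Rₚ P` at a prime of the regular locus is the
instance of record; nothing about `P` itself is used) -/

section Prime

variable {R : Type u} [CommRing R] (Rₚ : Type v) [CommRing Rₚ] [Algebra R Rₚ] [IsRegularLocalRing Rₚ]

/-- **(b) AT A PRIME `P` with `Rₚ` regular: `ord_P J ≥ m·S₀ ⟺ ord_P I ≥ m ∧ ord_P N ≥ S₀`**, orders read as `K·Rₚ ⊆ 𝔪_{Rₚ}^n`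
(`J = rowIdeal I N m S₀`; `m, S₀ ≥ 1`). [cite: ZariskiSamuel1960, Ch. VIII §1 Thm. 1] -/
theorem map_rowIdeal_le_iff_of_isLocalization (I N : Ideal R) {m S₀ : ℕ} (hm : 0 < m) (hS : 0 < S₀) :
    (rowIdeal I N m S₀).map (algebraMap R Rₚ) ≤ maximalIdeal Rₚ ^ (m * S₀) ↔
      I.map (algebraMap R Rₚ) ≤ maximalIdeal Rₚ ^ m ∧ N.map (algebraMap R Rₚ) ≤ maximalIdeal Rₚ ^ S₀ := by
  rw [map_rowIdeal]
  exact rowIdeal_le_maximalIdeal_pow_iff _ _ hm hS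

/-- The same in SYMBOLIC-POWER form: `J ≤ (𝔪_{Rₚ}^{m·S₀})^c` (contraction = `P^{(m·S₀)}`) iff `I ≤ P^{(m)}` and `N ≤ P^{(S₀)}`. [folklore] -/
theorem rowIdeal_le_comap_iff_of_isLocalization (I N : Ideal R) {m S₀ : ℕ} (hm : 0 < m) (hS : 0 < S₀) :
    rowIdeal I N m S₀ ≤ (maximalIdeal Rₚ ^ (m * S₀)).comap (algebraMap R Rₚ) ↔
      I ≤ (maximalIdeal Rₚ ^ m).comap (algebraMap R Rₚ) ∧ N ≤ (maximalIdeal Rₚ ^ S₀).comap (algebraMap R Rₚ) := by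
  simp only [← Ideal.map_le_iff_le_comap]
  exact map_rowIdeal_le_iff_of_isLocalization Rₚ I N hm hS

/-- **`Sing_{m·S₀}(J) = {ord I ≥ m} ∩ {ord N ≥ S₀}` POINTWISE over the regular locus**: the membership of the prime `P` in the `c`-fold locus of the
row ideal (read in `Rₚ`) is the conjunction of the two order conditions — the ROW STRATUM `T_{S₀}` (given `ord_P N ≤ S₀`, which holds on the tame row by
upper semicontinuity). [folklore] -/
theorem sing_rowIdeal_iff (I N : Ideal R) {m S₀ : ℕ} (hm : 0 < m) (hS : 0 < S₀) :
    (rowIdeal I N m S₀).map (algebraMap R Rₚ) ≤ maximalIdeal Rₚ ^ (m * S₀) ↔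
      I.map (algebraMap R Rₚ) ≤ maximalIdeal Rₚ ^ m ∧ N.map (algebraMap R Rₚ) ≤ maximalIdeal Rₚ ^ S₀ :=
  map_rowIdeal_le_iff_of_isLocalization Rₚ I N hm hS

/-! ## §4. (d) Permissibility corollary -/

/-- **(d) «`J`-PERMISSIBLE ⇒ `X`-LEGAL ∧ `N`-EQUIMULTIPLE» at ring level**: a prime `Q = P` (regular localisation) at which the row ideal has order
`≥ m·S₀` has `ord_P I ≥ m` (the centre `V(P)` lies in `{ord I ≥ m} = X_max` read on the contact threefold) and `ord_P N ≥ S₀` (it lies in the `S₀`-fold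
locus of the residual). The geometric clauses (normal flatness, B-snc) are the consumers' (060's CP-frame files). [folklore] -/
theorem order_le_of_rowIdeal_order_le (I N : Ideal R) {m S₀ : ℕ} (hm : 0 < m) (hS : 0 < S₀)
    (h : (rowIdeal I N m S₀).map (algebraMap R Rₚ) ≤ maximalIdeal Rₚ ^ (m * S₀)) :
    I.map (algebraMap R Rₚ) ≤ maximalIdeal Rₚ ^ m ∧ N.map (algebraMap R Rₚ) ≤ maximalIdeal Rₚ ^ S₀ :=
  (map_rowIdeal_le_iff_of_isLocalization Rₚ I N hm hS).mp h

end Prime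

end Summit.ResolutionOfSingularities.ResolutionOfSingularities.Theorems.SigmaMaxModificationsCorridor3.Sigma
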